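import Summits.AtomisticToContinuum.HydrodynamicLimit.Theses.EulerCharacteristics

/-!
# Birth skeleton (BC3) for the crux `TailBudget` (stmt-AtomisticToContinuum-14019)

Route `EulerCharacteristics` (sub-problem `HydrodynamicLimit`), crux rank 3:
`Summit.AtomisticToContinuum.HydrodynamicLimit.Theses.EulerCharacteristics.TailBudget` — the a-priori
TAIL/PACKING budget along the non-equilibrium hard-sphere flow, in probability: for every band `ηb`,
local-Gibbs data, `σ < σ₀`, classical dilute solution on `[0,T)` with `ρσ³ < ηb`, flow family with
the `t = 0` LLN, every `t < T` and `δ' > 0` there is `A > 0` with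
`LG_N {∃ r ∈ [0,t] : (cubic velocity tail above A at time r) > δ' ∨ (mass in ℓ_N-balls of coarse
reduced density > 2ηb at time r) > δ'} → 0`.

## The cut (the route's own two-layer plan: "TailBudget ⇐ VelocityTailBudget; the second child
DenseMassBudget is subsumed by the crux NoDenseInclusions at η₁ = 2ηb")

The crux event is a UNION over two physically unrelated a-priori walls, and the skeleton cuts it
exactly there:

* `stub_velocityTailBudget` — the VELOCITY half (HighMomentumCutoff wall; OllaVaradhanYau1993
  p. 525–526 (2.2)(iii), NachtergaeleYau2003 Assumption II.1): with the same quantifier prefix,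
  `∃ A > 0, LG_N {∃ r ∈ [0,t] : δ' < (N+1)⁻¹ Σᵢ (1+|vᵢ(r)|³) 1(|vᵢ(r)| > A)} → 0`.
  No condensation of cubic velocity mass into fast spheres, uniformly over the time continuum —
  a Povzner-type cascade bound in probability; beyond every entropy method (entropy is blind to
  cubic tails). Size: open problem (the crux's load-bearing half; the only half `FKTransferInProbR`
  consumes after rev 5).
* `stub_denseMassBudget` — the PACKING half in MASS form: with the same prefix (no `A`),
  `LG_N {∃ r ∈ [0,t] : δ' < ∫ 1(ρ^ℓ(r,x)σ³ > 2ηb) ρ^ℓ(r,x) dx} → 0`, `ρ^ℓ` the ball average at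
  radius `ℓ_N = (N+1)^{-1/4}`. No dense clumping beyond twice the band. Size: open problem, but
  IMPLIED by the route's sup-form packing cap `NoDenseInclusions` (shared stmt-14425) at
  `η₁ := 2ηb` — certified below, sorry-free (`denseMassBudget_of_noDenseInclusions`): if no ball
  is over-packed the integrand vanishes identically, so the integral is `0 < δ'`.

`TailBudget_of : stub_velocityTailBudget → stub_denseMassBudget → TailBudget` is a real proof
(`σ₀ := min σ_V σ_M`; `A` from the velocity half; event inclusion
`E ⊆ E_V ∪ E_M` through the `let`-bound ball kernel; sub-additivity of the (outer) local Gibbs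
measure — no measurability needed; squeeze `0 ≤ LG(E) ≤ LG(E_V) + LG(E_M) → 0` in `ℝ≥0∞`).
Neither stub is cheaply the crux or the summit: each controls ONE of the two disjuncts only
(BC3 probes `stub → TailBudget`, `stub → _root_.HydrodynamicLimit` by
`first | exact? | simpa | aesop` fail, see the probe files / NOTES.md of the registering seat).

D-0027 §3.3 shape: sorried theorems `Holds.stub_*`, their statements by name (`def stub_* : Prop`),
the composition `TailBudget_of`, and `TailBudget_proof : TailBudget` from the registered stubs.
Disproof used: no `Cruxes/TailBudget/Disproof.lean` exists yet (`ledger crux ls`, 2026-08-17);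
the refuted exponential predecessor `ExpTailBudget` (stmt-14607,
`EulerCharacteristicsExpTailBudget_refuted`) is honoured: both stubs conclude IN PROBABILITY, no rate.
-/

noncomputable section

namespace Summit.AtomisticToContinuum.HydrodynamicLimit.Cruxes.TailBudget.Birth

open MeasureTheory Filter Set Topology
open scoped ENNReal
open Literature.MathematicalPhysics.KineticTheory Literature.Analysis.FluidPDE

/-! ## Two generic measure lemmas (the whole analytic content of the composition) -/

/-- Squeeze for a union bound: if `E i ⊆ EV i ∪ EM i` and both majorants have measure `→ 0`
along `l`, so does `E` (outer measure: no measurability). -/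
theorem tendsto_zero_of_subset_union {ι : Type*} {l : Filter ι} {α : ι → Type*}
    [∀ i, MeasurableSpace (α i)] (μ : (i : ι) → Measure (α i)) {E EV EM : (i : ι) → Set (α i)}
    (hV : Tendsto (fun i => μ i (EV i)) l (𝓝 0)) (hM : Tendsto (fun i => μ i (EM i)) l (𝓝 0))
    (hsub : ∀ i, E i ⊆ EV i ∪ EM i) : Tendsto (fun i => μ i (E i)) l (𝓝 0) := by
  have hsum : Tendsto (fun i => μ i (EV i) + μ i (EM i)) l (𝓝 0) := by
    simpa using hV.add hM
  exact tendsto_of_tendsto_of_tendsto_of_le_of_le tendsto_const_nhds hsum (fun _ => zero_le)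
    (fun i => (measure_mono (hsub i)).trans (measure_union_le _ _))

/-- Squeeze for a single inclusion. -/
theorem tendsto_zero_of_subset {ι : Type*} {l : Filter ι} {α : ι → Type*}
    [∀ i, MeasurableSpace (α i)] (μ : (i : ι) → Measure (α i)) {E F : (i : ι) → Set (α i)}
    (hF : Tendsto (fun i => μ i (F i)) l (𝓝 0)) (hsub : ∀ i, E i ⊆ F i) :
    Tendsto (fun i => μ i (E i)) l (𝓝 0) :=
  tendsto_of_tendsto_of_tendsto_of_le_of_le tendsto_const_nhds hF (fun _ => zero_le)
    (fun i => measure_mono (hsub i))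

/-- If `δ ≥ 0` is strictly below `∫ 1(P) g`, then `P` holds somewhere (otherwise the integrand is
identically `0`). -/
theorem exists_of_lt_integral_ite {X : Type*} [MeasurableSpace X] {μ : Measure X} {δ : ℝ}
    (hδ : 0 ≤ δ) {P : X → Prop} {hP : ∀ x, Decidable (P x)} {g : X → ℝ}
    (h : δ < ∫ x, (@ite _ (P x) (hP x) (g x) 0) ∂μ) : ∃ x, P x := by
  by_contra hno
  have hz : (fun x => @ite _ (P x) (hP x) (g x) 0) = fun _ => 0 :=
    funext fun x => if_neg fun hx => hno ⟨x, hx⟩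
  rw [hz, integral_zero] at h
  exact absurd h (not_lt.mpr hδ)

/-! ## Registered stubs (`Holds.stub_*`, bodies `sorry`) -/

namespace Holds

/-- STUB 1 — VELOCITY TAIL BUDGET (the crux's load-bearing half; size: open problem).
Same quantifier prefix as the crux; conclusion = its FIRST disjunct only:
`∃ A > 0, LG_N {∃ r ∈ [0,t] : δ' < ∫ (1+‖v‖³) 1(A < ‖v‖) d(empirical measure of (Φ N).flow r z)} → 0`.
Why plausibly true: at `t = 0` by the finite-variance LLN for the cubic tail given positions; on the
homogeneous equilibrium flow by invariance + a union over `≍ tN^{4/3}` velocity-changing collisions of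
a stretched-exponentially rare static event; pre-shock the classical solution has bounded temperature.
Why it might fail: velocity tails along the deterministic NON-equilibrium flow are beyond every
known technique (entropy bounds are blind to cubic tails; no maximum principle for collision
cascades) — one pre-shock focusing event of LG-probability not → 0 refutes it.
Sources: OllaVaradhanYau1993 p. 525–526 (2.2)(iii); NachtergaeleYau2003 Assumption II.1; Sideris1985;
`Literature.Barriers.AtomisticToContinuum.HighMomentumCutoffBarrier`. -/
theorem stub_velocityTailBudget : ∀ ηb : ℝ, 0 < ηb → ∀ (a₀ θ₀ : Literature.MathematicalPhysics.KineticTheory.T3 → ℝ) (u₀ : Literature.MathematicalPhysics.KineticTheory.T3 → Literature.MathematicalPhysics.KineticTheory.V3), Continuous a₀ → Continuous θ₀ → Continuous u₀ → (∀ x, 0 < a₀ x) → (∀ x, 0 < θ₀ x) → ∃ σ₀ : ℝ, 0 < σ₀ ∧ ∀ σ : ℝ, 0 < σ → σ < σ₀ → ∀ (T : ℝ) (ρ θ : ℝ → Literature.MathematicalPhysics.KineticTheory.T3 → ℝ) (u : ℝ → Literature.MathematicalPhysics.KineticTheory.T3 → Literature.MathematicalPhysics.KineticTheory.V3), Literature.MathematicalPhysics.KineticTheory.IsHardSphereEulerSolution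 σ T ρ u θ → (∀ t ∈ Set.Ico 0 T, ∀ x, ρ t x * σ ^ 3 < ηb) → ∀ Φ : (N : ℕ) → Literature.Analysis.FluidPDE.HardSphereFlow (Literature.Analysis.FluidPDE.Torus.geometry (Fin 3)) (Literature.MathematicalPhysics.KineticTheory.hsDiameter σ N) (N + 1), Literature.MathematicalPhysics.KineticTheory.TendstoHydroFieldsAt (fun N => Literature.MathematicalPhysics.KineticTheory.localGibbsLaw σ a₀ u₀ θ₀ N (Φ N)) Φ ρ u θ 0 → ∀ t ∈ Set.Ico 0 T, ∀ δ' : ℝ, 0 < δ' → ∃ A : ℝ, 0 < A ∧ Filter.Tendsto (fun N : ℕ => Literature.MathematicalPhysics.KineticTheory.localGibbsLaw σ a₀ u₀ θ₀ N (Φ N) {z | ∃ r ∈ Set.Icc 0 t, δ' < ∫ y, (1 + ‖y.2‖ ^ 3) * (if A < ‖y.2‖ then (1 : ℝ) else 0) ∂Literature.Analysis.FluidPDE.empiricalMeasure ((Φ N).flow r z)}) Filter.atTop (nhds 0) := by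
  sorry

/-- STUB 2 — DENSE-MASS BUDGET (the crux's packing half, mass form; size: open problem as stated,
but a CONSEQUENCE of the route's crux `NoDenseInclusions` (stmt-14425) at `η₁ := 2ηb`, see
`denseMassBudget_of_noDenseInclusions`). Same prefix as the crux; conclusion = its SECOND disjunct:
`LG_N {∃ r ∈ [0,t] : δ' < ∫ 1(ρ^ℓ(r,x)σ³ > 2ηb) ρ^ℓ(r,x) dx} → 0`, `ρ^ℓ` the sharp-ball average of
the empirical density at radius `ℓ_N = (N+1)^{-1/4}` (kernel written inline exactly as in the crux).
Why plausibly true: at `t = 0` an over-packed ball costs `≍ e^{-cN^{1/4}}` under the low-activity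
local Gibbs law (`N^{3/4}` balls); pre-shock the PDE density stays `< ηb`, half the threshold.
Why it might fail: a mesoscopic implosion (`≍ N^{1/4}` spheres focused into one ball) carrying
mass `δ'` needs `≍ δ'N^{3/4}` imploded balls — nothing macroscopic drives it pre-shock, but no
a-priori density bound for deterministic spheres exists.
Sources: Spohn1991 Part I Ch. 3; OllaVaradhanYau1993 §1; route item NoDenseInclusions (stmt-14425). -/
theorem stub_denseMassBudget : ∀ ηb : ℝ, 0 < ηb → ∀ (a₀ θ₀ : Literature.MathematicalPhysics.KineticTheory.T3 → ℝ) (u₀ : Literature.MathematicalPhysics.KineticTheory.T3 → Literature.MathematicalPhysics.KineticTheory.V3), Continuous a₀ → Continuous θ₀ → Continuous u₀ → (∀ x, 0 < a₀ x) → (∀ x, 0 < θ₀ x) → ∃ σ₀ : ℝ, 0 < σ₀ ∧ ∀ σ : ℝ, 0 < σ → σ < σ₀ → ∀ (T : ℝ) (ρ θ : ℝ → Literature.MathematicalPhysics.KineticTheory.T3 → ℝ) (u : ℝ → Literature.MathematicalPhysics.KineticTheory.T3 → Literature.MathematicalPhysics.KineticTheory.V3), Literature.MathematicalPhysics.KineticTheory.IsHardSphereEulerSolution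 σ T ρ u θ → (∀ t ∈ Set.Ico 0 T, ∀ x, ρ t x * σ ^ 3 < ηb) → ∀ Φ : (N : ℕ) → Literature.Analysis.FluidPDE.HardSphereFlow (Literature.Analysis.FluidPDE.Torus.geometry (Fin 3)) (Literature.MathematicalPhysics.KineticTheory.hsDiameter σ N) (N + 1), Literature.MathematicalPhysics.KineticTheory.TendstoHydroFieldsAt (fun N => Literature.MathematicalPhysics.KineticTheory.localGibbsLaw σ a₀ u₀ θ₀ N (Φ N)) Φ ρ u θ 0 → ∀ t ∈ Set.Ico 0 T, ∀ δ' : ℝ, 0 < δ' → Filter.Tendsto (fun N : ℕ => Literature.MathematicalPhysics.KineticTheory.localGibbsLaw σ a₀ u₀ θ₀ N (Φ N) {z | ∃ r ∈ Set.Icc 0 t, (let ℓ : ℝ := ((N + 1 : ℕ) : ℝ) ^ (-(1 / 4 : ℝ)); let χ : Literature.MathematicalPhysics.KineticTheory.T3 → Literature.MathematicalPhysics.KineticTheory.T3 → ℝ := fun x y => if Literature.Analysis.FluidPDE.Torus.euclidDist x y < ℓ then (4 / 3 * Real.pi * ℓ ^ 3)⁻¹ else 0; let ρℓ : Literature.MathematicalPhysics.KineticTheory.T3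 → ℝ := fun x => Literature.MathematicalPhysics.KineticTheory.empiricalDensityField ((Φ N).flow r z) (χ x); δ' < ∫ x, (if 2 * ηb < ρℓ x * σ ^ 3 then ρℓ x else 0))}) Filter.atTop (nhds 0) := by
  sorry

end Holds

/-! ## Statements of the registered stubs, by name -/

/-- Statement of registered stub 1 (`Holds.stub_velocityTailBudget`), by name. -/
def stub_velocityTailBudget : Prop := type_of% Holds.stub_velocityTailBudget
/-- Statement of registered stub 2 (`Holds.stub_denseMassBudget`), by name. -/
def stub_denseMassBudget : Prop := type_of% Holds.stub_denseMassBudget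

/-! ## Composition (sorry-free): the two stubs ⟹ the crux BY NAME -/

/-- **The skeleton theorem.** `σ₀ := min σ_V σ_M`; for `σ < σ₀`, a dilute classical solution, a
flow family with the `t = 0` LLN, `t < T` and `δ' > 0`: take `A` from the velocity half; the crux
event at `N` is contained in the union of the two stub events (the `let`-bound ball kernel is the
crux's, verbatim), so its local-Gibbs probability is squeezed between `0` and a sum tending to `0`. -/
theorem TailBudget_of (hV : stub_velocityTailBudget) (hM : stub_denseMassBudget) :
    Summit.AtomisticToContinuum.HydrodynamicLimit.Theses.EulerCharacteristics.TailBudget := by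
  intro ηb hηb a₀ θ₀ u₀ ha hθ hu ha0 hθ0
  obtain ⟨σ₁, hσ₁, H1⟩ :=
    (hV : type_of% Holds.stub_velocityTailBudget) ηb hηb a₀ θ₀ u₀ ha hθ hu ha0 hθ0
  obtain ⟨σ₂, hσ₂, H2⟩ :=
    (hM : type_of% Holds.stub_denseMassBudget) ηb hηb a₀ θ₀ u₀ ha hθ hu ha0 hθ0
  refine ⟨min σ₁ σ₂, lt_min hσ₁ hσ₂, ?_⟩
  intro σ hσ hσlt T ρ θ u hsol hband Φ h0 t ht δ' hδ'
  obtain ⟨A, hA, hVt⟩ :=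
    H1 σ hσ (lt_of_lt_of_le hσlt (min_le_left _ _)) T ρ θ u hsol hband Φ h0 t ht δ' hδ'
  have hMt := H2 σ hσ (lt_of_lt_of_le hσlt (min_le_right _ _)) T ρ θ u hsol hband Φ h0 t ht δ' hδ'
  refine ⟨A, hA, ?_⟩
  refine tendsto_zero_of_subset_union
    (fun N => Literature.MathematicalPhysics.KineticTheory.localGibbsLaw σ a₀ u₀ θ₀ N (Φ N)) hVt hMt
    (fun N z hz => ?_)
  obtain ⟨r, hr, h⟩ := hz
  rcases h with h | h
  · exact Or.inl ⟨r, hr, h⟩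
  · exact Or.inr ⟨r, hr, h⟩

/-- D-0027 §3.3 shape, skeleton-check form: the crux from the REGISTERED stubs — it becomes the
proof of the item once the two `sorry`s inside `Holds.stub_*` are discharged (until then it depends
on `sorryAx` through them and credits nothing). -/
theorem TailBudget_proof :
    Summit.AtomisticToContinuum.HydrodynamicLimit.Theses.EulerCharacteristics.TailBudget :=
  TailBudget_of Holds.stub_velocityTailBudget Holds.stub_denseMassBudget

/-! ## Docking certificate (sorry-free): the packing half is subsumed by the route's crux
`NoDenseInclusions` (stmt-AtomisticToContinuum-14425) at `η₁ := 2ηb` -/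

/-- `NoDenseInclusions → stub_denseMassBudget`: under the PDE band `ρσ³ < ηb` on `[0,T)` the
sup-form cap at `η₁ = 2ηb` applies on `[0,t]` (`ρσ³ ≤ η₁/2`); and the mass event is contained in
the sup event — if `δ' < ∫ 1(ρ^ℓσ³ > 2ηb) ρ^ℓ` with `δ' > 0` then some ball is over-packed
(`exists_of_lt_integral_ite`; the crux's `let`-bound kernel and the cap's inline kernel are the
same term). So, GIVEN the route's other crux, `TailBudget` reduces to `stub_velocityTailBudget`
alone (the route's two-layer plan, rev 5). -/
theorem denseMassBudget_of_noDenseInclusions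
    (hD : Summit.AtomisticToContinuum.HydrodynamicLimit.Theses.EulerCharacteristics.NoDenseInclusions) :
    stub_denseMassBudget := by
  intro ηb hηb a₀ θ₀ u₀ ha hθ hu ha0 hθ0
  obtain ⟨σ₀, hσ₀, H⟩ := hD (2 * ηb) (by positivity) a₀ θ₀ u₀ ha hθ hu ha0 hθ0
  refine ⟨σ₀, hσ₀, fun σ hσ hσlt T ρ θ u hsol hband Φ h0 t ht δ' hδ' => ?_⟩
  have hcap : ∀ r ∈ Set.Icc 0 t, ∀ x, ρ r x * σ ^ 3 ≤ 2 * ηb / 2 := fun r hr x => by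
    have hlt := hband r ⟨hr.1, lt_of_le_of_lt hr.2 ht.2⟩ x
    linarith
  have hDt := H σ hσ hσlt T ρ θ u hsol Φ h0 t ht hcap
  refine tendsto_zero_of_subset
    (fun N => Literature.MathematicalPhysics.KineticTheory.localGibbsLaw σ a₀ u₀ θ₀ N (Φ N)) hDt
    (fun N z hz => ?_)
  obtain ⟨r, hr, h⟩ := hz
  exact ⟨r, hr, exists_of_lt_integral_ite hδ'.le h⟩

end Summit.AtomisticToContinuum.HydrodynamicLimit.Cruxes.TailBudget.Birth

end
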